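import Literature.Algebra.EuclideanLattices.GapCVPPrimeMachine
import Literature.Algebra.EuclideanLattices.LatticeComplexity
import Literature.Computability.Complexity.PromiseCookReductionsProofs
import Literature.Computability.Complexity.PromiseZPPProofs
import HarnessLib

/-!
# Route SzkEntropy, crux `PeaThreeNotInP` (stmt-PneNP-10776), line `SketchIdeator3`, socket rider:
# lattice glue — hardness of `GapSVP_γ` gives hardness of `GapCVP_γ` (promise-`P`)

Groundwork for the socket client `lattice-cube-smoothing` (crux idea card, filed for triage): the
card's transfer hypothesis is the retired Lattice route's thesis `LatticeGapsvpNNotP`, i.e.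
`gapSVPPromise (fun n => n) ∉ PromiseP` (definitionally), while its reduction starts from
`gapCVPPromise (fun n => n)`.  The tree's PROVED Goldreich–Micciancio–Safra–Seifert Cook reduction
`gapSVP_cookReducible_gapCVP'_holds` (GapSVP_γ ≤_Cook GapCVP′_γ, Micciancio–Regev Lemma 5.22) and the
inclusion of the promise of `GapCVP′_γ` in that of `GapCVP_γ` give, for EVERY factor `γ`:

(helpers reused: `promiseLift_anti`, `GapCVP'.no_subset_gapCVP_no`)

* `gapCVPPromise_mem_PromiseP_imp : gapCVPPromise γ ∈ PromiseP → gapSVPPromise γ ∈ PromiseP`,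
* `gapCVPPromise_not_mem_of_gapSVPPromise_not_mem : gapSVPPromise γ ∉ PromiseP → gapCVPPromise γ ∉ PromiseP`.

Sources: O. Goldreich, D. Micciancio, S. Safra, J.-P. Seifert, IPL 71 (1999); D. Micciancio,
O. Regev, *Lattice-based cryptography* (2009 authors' version), Lemma 5.22; O. Goldreich, *On promise
problems* (2006), Def. 1.2 and §1.2 Def. 3.
-/

namespace Summit.PneNP.PneNP.Cruxes.PeaThreeNotInP.SocketBP

set_option linter.dupNamespace false -- `Summit.PneNP.PneNP.…`: summit = sub-problem name (D-0017)

open _root_.Computability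
open Literature.Computability.Complexity
open Literature.Algebra.EuclideanLattices

/-- **If `GapCVP_γ` is in promise-`P` then so is `GapSVP_γ`** (GMSS Cook reduction through
`GapCVP′_γ`, whose promise is contained in that of `GapCVP_γ`).
[cite: GoldreichMicciancioSafraSeifert1999, Thm 1; MicciancioRegev2007, Lemma 5.22] -/
theorem gapCVPPromise_mem_PromiseP_imp (γ : ℕ → ℝ) (h : gapCVPPromise γ ∈ PromiseP) :
    gapSVPPromise γ ∈ PromiseP := by
  -- the restricted problems of the Cook theorem, at `T = univ`
  set Qc : PromiseProblem := PromiseProblem.ofEncoding gapCVPInstanceEncoding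
    {p | p ∈ GapCVP'.yes γ ∧ p.1.I.n ∈ (Set.univ : Set ℕ)}
    {p | p ∈ GapCVP'.no γ ∧ p.1.I.n ∈ (Set.univ : Set ℕ)} with hQc
  set Qs : PromiseProblem := PromiseProblem.ofEncoding gapSVPInstanceEncoding
    {p | p ∈ GapSVP.yes γ ∧ p.1.n ∈ (Set.univ : Set ℕ)}
    {p | p ∈ GapSVP.no γ ∧ p.1.n ∈ (Set.univ : Set ℕ)} with hQs
  have hcook : Qs.CookReducible Qc := gapSVP_cookReducible_gapCVP'_holds γ Set.univ
  -- `Qc` is a sub-promise of `gapCVPPromise γ`, hence in `PromiseP`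
  have hQc_mem : Qc ∈ PromiseP := by
    refine promiseLift_anti ?_ ?_ h
    · rintro w ⟨p, ⟨hp, -⟩, rfl⟩
      exact ⟨p, (GapCVP'.yes_eq_gapCVP_yes γ) ▸ hp, rfl⟩
    · rintro w ⟨p, ⟨hp, -⟩, rfl⟩
      exact ⟨p, GapCVP'.no_subset_gapCVP_no γ hp, rfl⟩
  have hQs_mem : Qs ∈ PromiseP :=
    PromiseProblem.mem_PromiseP_of_cookReducible_holds _ _ hcook hQc_mem
  -- `Qs` has the same promise as `gapSVPPromise γ`
  refine promiseLift_anti ?_ ?_ hQs_mem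
  · rintro w ⟨p, hp, rfl⟩
    exact ⟨p, ⟨hp, Set.mem_univ _⟩, rfl⟩
  · rintro w ⟨p, hp, rfl⟩
    exact ⟨p, ⟨hp, Set.mem_univ _⟩, rfl⟩

/-- **Hardness transfer `GapSVP_γ ∉ prP ⟹ GapCVP_γ ∉ prP`** for every factor `γ`; with
`γ n = n` the hypothesis is literally the Lattice route's thesis `LatticeGapsvpNNotP`.
[cite: GoldreichMicciancioSafraSeifert1999, Thm 1] -/
theorem gapCVPPromise_not_mem_of_gapSVPPromise_not_mem (γ : ℕ → ℝ)
    (h : gapSVPPromise γ ∉ PromiseP) : gapCVPPromise γ ∉ PromiseP :=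
  fun hc => h (gapCVPPromise_mem_PromiseP_imp γ hc)

end Summit.PneNP.PneNP.Cruxes.PeaThreeNotInP.SocketBP
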